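import Literature.Computability.QuantumComplexity.ApproxImplementation
import Literature.Computability.QuantumComplexity.WireConjugation
import Literature.Computability.QuantumComplexity.CoinFamilyKernel
import Literature.Computability.Cryptography.QuantumCircuitProofs
import HarnessLib

/-!
# Substituting approximate implementations for the oracle gates of a circuit family

Topic `Literature/Computability/QuantumComplexity`; first file of the discharge of the named fact
`Literature.Computability.Cryptography.isQSolvable_of_mem_BQP_oracle` (`Cryptography/ShorAssembly.lean`:
a `BQP` oracle inside a bounded-error quantum search can be removed — Bennett–Bernstein–Brassard–
Vazirani 1997, Cor. 4.15 `BQP^BQP = BQP`, from the *tidy* subroutines of their Thm. 4.14).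

This file PROVES the state-vector and measurement half of Cor. 4.15 in the tree's circuit model,
for an arbitrary assignment `B : OracleImpl G` of oracle-free *blocks* `B.circ k` on
`(k + 1) + B.anc k` wires to the query lengths `k` (the circuit `B.circ k` is meant to implement
the XOR query gate `oracleGate A k ⊗ 1` on inputs whose `B.anc k` ancilla wires read `0`, up to
`ε` in operator norm — `OracleImpl.Implements`, the `ImplOn` relation of
`ApproxImplementation.lean`; BBBV's tidy machines, Thm. 4.14, have this property):

* `OracleImpl.substGates B hNW off gs` — the gate list `gs` (on `N` wires, inside an ambient
  register of `W ≥ N` wires) in which every gate symbol is kept (on the same wire numbers) and the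
  `t`-th oracle gate `oracle k e` is replaced by the gates of `B.circ k`, its `k + 1` query/answer
  wires placed along `e` and its ancillas on the FRESH wires `off_t, …, off_t + B.anc k - 1`,
  `off_t = off + (ancillas of the earlier blocks)` (`OracleImpl.blockEmb`); `OracleImpl.extra B gs`
  is the total number of fresh wires, `numOracle gs` the number of oracle gates;
* **`OracleImpl.implOn_substGates`** — if `B` implements `A` up to `ε`, the substituted list
  implements `U^A_{gs} ⊗ 1` (the original circuit run WITH the oracle, idle on the fresh wires) up
  to `numOracle gs · ε` on inputs whose wires `≥ N` read `0` (errors add along the product,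
  Bernstein–Vazirani 1997, §6; Nielsen–Chuang 2010, Box 4.1 — the tree's `ImplOn.mul`; each block
  is transported along its placement by `ImplOn.placeGate`);
* `OracleImpl.substFamily F B` — the oracle-free family obtained from a family `F` with oracle
  gates (blocks `B n` at input length `n`, fresh wires appended after `F`'s ancillas), and
  **`OracleImpl.kernelProb_substFamily_ge`**: for every event `E`,
  `P_F^A[y ++ 0^X ∈ E] − numOracle · ε ≤ P_{F'}[output ∈ E]` (`X` the number of fresh wires):
  in the ideal run the fresh wires stay `0`, and close final states have close statistics
  (BBBV Thm. 3.1, the tree's `abs_sum_normSq_sub_le_of_implOn`).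

The existence of uniform tidy blocks for `A ∈ BQP` (BBBV Thm. 4.13–4.14) and the uniformity of
`substFamily` are the remaining (separately vendored) ingredients of Cor. 4.15.

## References

* C. H. Bennett, E. Bernstein, G. Brassard, U. Vazirani, *Strengths and weaknesses of quantum
  computing*, SIAM J. Comput. 26 (1997) 1510–1523 (arXiv:quant-ph/9701001, pp. 11–13): §4
  (subroutines must clean up), Thm. 4.14 (tidy machines), Cor. 4.15 (`BQP^BQP = BQP`, stated
  without proof), Thm. 3.1 (close superpositions give close distributions)
  [BennettBernsteinBrassardVazirani1997].
* E. Bernstein, U. Vazirani, *Quantum complexity theory*, SIAM J. Comput. 26 (1997), §6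
  (accumulation of errors), §8.3 (oracle machines) [BernsteinVazirani1997].
* M. A. Nielsen, I. L. Chuang, *Quantum Computation and Quantum Information*, CUP 2010, §4.5.3
  Box 4.1, §4.3 [NielsenChuang2010].
-/

noncomputable section

namespace Literature.Computability.QuantumComplexity

open Cryptography Matrix

variable {G : QGateSet}

/-! ### Blocks implementing oracle gates -/

/-- An assignment of oracle-free *blocks* to the query lengths: for each `k`, a circuit on
`(k + 1) + anc k` wires meant to replace the XOR query gate on `k` query wires and one answer
wire, using `anc k` fresh ancillas (BBBV's tidy subroutine for inputs of length `k`).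
[cite: BennettBernsteinBrassardVazirani1997, Thm. 4.14 and Cor. 4.15] -/
structure OracleImpl (G : QGateSet) where
  /-- the number of ancilla wires of the block for query length `k` -/
  anc : ℕ → ℕ
  /-- the block for query length `k`: wires `0 … k-1` query, wire `k` answer, then the ancillas -/
  circ : (k : ℕ) → QCircuit G (k + 1 + anc k)

namespace OracleImpl

/-- The clean-ancilla inputs of a block on `(k + 1) + a` wires: every wire `≥ k + 1` reads `0`.
[folklore] -/
def Clean (k a : ℕ) : Set (QReg (k + 1 + a)) :=
  {z | ∀ i : Fin (k + 1 + a), k + 1 ≤ (i : ℕ) → z i = false}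

/-- **`B` implements the oracle `A` up to `ε`**: every block is oracle-free and, on inputs whose
ancillas read `0`, is within `ε` (in the sense of `ImplOn`: `‖B ψ − (U_A ⊗ 1) ψ‖₂ ≤ ε ‖ψ‖₂`) of the
XOR query gate of `A` acting on its first `k + 1` wires — the property of a tidy subroutine
("produces a final superposition in which `|x⟩|L(x)⟩` has squared magnitude at least `1 − ε`",
with the workspace returned to `0`). [cite: BennettBernsteinBrassardVazirani1997, Thm. 4.14] -/
structure Implements (B : OracleImpl G) (A : Language Bool) (ε : ℝ) : Prop where
  /-- the blocks are oracle-free -/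
  isOracleFree : ∀ k, (B.circ k).IsOracleFree
  /-- each block implements `oracleGate A k ⊗ 1` on clean inputs up to `ε` -/
  implOn : ∀ k, ImplOn (Clean k (B.anc k)) (B.circ k).mat
    (placeGate (Fin.castAddEmb (B.anc k)) (oracleGate A k)) ε

/-! ### Placing a block: query/answer wires along `e`, ancillas on fresh wires -/

section Emb

variable {k N W : ℕ}

/-- The wire map of a placed block: the first `k + 1` wires go along `e` (into the first `N`
wires of the ambient register of `W` wires), ancilla `j` goes to the fresh wire `off + j`.
[folklore] -/
def blockMap (e : Fin (k + 1) ↪ Fin N) (off a : ℕ) (hN : N ≤ off) (hW : off + a ≤ W)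
    (i : Fin (k + 1 + a)) : Fin W :=
  Fin.addCases (motive := fun _ => Fin W)
    (fun j => ⟨e j, lt_of_lt_of_le (e j).isLt (hN.trans ((Nat.le_add_right off a).trans hW))⟩)
    (fun j => ⟨off + j, by omega⟩) i

/-- `blockMap` on a query/answer wire. [folklore] -/
@[simp] theorem blockMap_castAdd (e : Fin (k + 1) ↪ Fin N) (off a : ℕ) (hN : N ≤ off)
    (hW : off + a ≤ W) (j : Fin (k + 1)) :
    blockMap e off a hN hW (Fin.castAdd a j) = ⟨e j, lt_of_lt_of_le (e j).isLt
      (hN.trans ((Nat.le_add_right off a).trans hW))⟩ := by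
  simp [blockMap]

/-- `blockMap` on an ancilla wire. [folklore] -/
@[simp] theorem blockMap_natAdd (e : Fin (k + 1) ↪ Fin N) (off a : ℕ) (hN : N ≤ off)
    (hW : off + a ≤ W) (j : Fin a) :
    blockMap e off a hN hW (Fin.natAdd (k + 1) j) = ⟨off + j, by omega⟩ := by
  simp [blockMap]

/-- The value of `blockMap` on a query/answer wire is below `N`. [folklore] -/
theorem blockMap_castAdd_lt (e : Fin (k + 1) ↪ Fin N) (off a : ℕ) (hN : N ≤ off)
    (hW : off + a ≤ W) (j : Fin (k + 1)) : ((blockMap e off a hN hW (Fin.castAdd a j) : Fin W) : ℕ) < N := by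
  rw [blockMap_castAdd]; exact (e j).isLt

/-- The value of `blockMap` on an ancilla wire is at least `off ≥ N`. [folklore] -/
theorem le_blockMap_natAdd (e : Fin (k + 1) ↪ Fin N) (off a : ℕ) (hN : N ≤ off)
    (hW : off + a ≤ W) (j : Fin a) : off ≤ ((blockMap e off a hN hW (Fin.natAdd (k + 1) j) : Fin W) : ℕ) := by
  rw [blockMap_natAdd]; exact Nat.le_add_right _ _

/-- `blockMap` is injective. [folklore] -/
theorem blockMap_injective (e : Fin (k + 1) ↪ Fin N) (off a : ℕ) (hN : N ≤ off) (hW : off + a ≤ W) :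
    Function.Injective (blockMap e off a hN hW) := by
  intro i i' h
  induction i using Fin.addCases with
  | left j =>
    induction i' using Fin.addCases with
    | left j' =>
      rw [blockMap_castAdd, blockMap_castAdd] at h
      have : e j = e j' := Fin.ext (by simpa using congrArg Fin.val h)
      rw [e.injective this]
    | right j' =>
      exfalso
      have h1 := blockMap_castAdd_lt e off a hN hW j
      have h2 := le_blockMap_natAdd e off a hN hW j'
      rw [h] at h1
      omega
  | right j =>
    induction i' using Fin.addCases with
    | left j' =>
      exfalso
      have h1 := blockMap_castAdd_lt e off a hN hW j'
      have h2 := le_blockMap_natAdd e off a hN hW j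
      rw [h] at h2
      omega
    | right j' =>
      rw [blockMap_natAdd, blockMap_natAdd] at h
      have : (j : ℕ) = j' := by simpa using congrArg Fin.val h
      rw [Fin.ext this]

/-- **The placement of a block**: query/answer wires along `e`, ancilla `j` on the fresh wire
`off + j`. [cite: BennettBernsteinBrassardVazirani1997, Cor. 4.15] -/
def blockEmb (e : Fin (k + 1) ↪ Fin N) (off a : ℕ) (hN : N ≤ off) (hW : off + a ≤ W) :
    Fin (k + 1 + a) ↪ Fin W :=
  ⟨blockMap e off a hN hW, blockMap_injective e off a hN hW⟩

/-- `blockEmb` as a function is `blockMap`. [folklore] -/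
@[simp] theorem blockEmb_apply (e : Fin (k + 1) ↪ Fin N) (off a : ℕ) (hN : N ≤ off)
    (hW : off + a ≤ W) (i : Fin (k + 1 + a)) : blockEmb e off a hN hW i = blockMap e off a hN hW i := rfl

/-- Restricted to the query/answer wires, the block placement is `e` followed by the inclusion of
the first `N` wires. [folklore] -/
theorem castAddEmb_trans_blockEmb (e : Fin (k + 1) ↪ Fin N) (off a : ℕ) (hN : N ≤ off)
    (hW : off + a ≤ W) (hNW : N ≤ W) :
    (Fin.castAddEmb a).trans (blockEmb e off a hN hW) = e.trans (Fin.castLEEmb hNW) := by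
  ext j
  simp [Function.Embedding.trans_apply, Fin.castAddEmb_apply]

end Emb

/-! ### The substituted gate list -/

section Subst

variable {N W : ℕ}

/-- **The substituted gate list** (inside an ambient register of `W ≥ N` wires, with the fresh
wires allocated upwards from `off`): gate symbols are kept on the same wires; an oracle gate
`oracle k e` becomes the block `B.circ k` placed with its query/answer wires along `e` and its
ancillas on `off, …, off + B.anc k - 1`, after which `off` advances by `B.anc k`. (If the block
does not fit — never the case in `substFamily` — the oracle gate is dropped.)
[cite: BennettBernsteinBrassardVazirani1997, Cor. 4.15 (BQP^BQP = BQP: replace each oracle call by a tidy machine)] -/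
def substGates (B : OracleImpl G) (hNW : N ≤ W) : ℕ → List (QGate G N) → List (QGate G W)
  | _, [] => []
  | off, QGate.gate s e :: gs =>
      mapWiresGate (Fin.castLEEmb hNW) (QGate.gate s e) :: substGates B hNW off gs
  | off, QGate.oracle k e :: gs =>
      if h : N ≤ off ∧ off + B.anc k ≤ W then
        (mapWires (blockEmb e off (B.anc k) h.1 h.2) (B.circ k)).gates ++
          substGates B hNW (off + B.anc k) gs
      else substGates B hNW off gs

/-- The number of fresh wires used by the substitution: the total ancilla count of the blocks
of the oracle gates of the list. [folklore] -/
def extra (B : OracleImpl G) : List (QGate G N) → ℕ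
  | [] => 0
  | QGate.gate _ _ :: gs => extra B gs
  | QGate.oracle k _ :: gs => B.anc k + extra B gs

/-- The number of oracle gates of a gate list. [folklore] -/
def numOracle : List (QGate G N) → ℕ
  | [] => 0
  | QGate.gate _ _ :: gs => numOracle gs
  | QGate.oracle _ _ :: gs => numOracle gs + 1

/-- `numOracle` is at most the length of the list. [folklore] -/
theorem numOracle_le_length : ∀ gs : List (QGate G N), numOracle gs ≤ gs.length
  | [] => le_rfl
  | QGate.gate _ _ :: gs => (numOracle_le_length gs).trans (Nat.le_succ _)
  | QGate.oracle _ _ :: gs => Nat.succ_le_succ (numOracle_le_length gs)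

/-- `numOracle` counts the gates that are not oracle-free (the tree's `QCircuit.oracleQueries`).
[folklore] -/
theorem numOracle_eq_oracleQueries (gs : List (QGate G N)) :
    numOracle gs = (⟨gs⟩ : QCircuit G N).oracleQueries := by
  unfold QCircuit.oracleQueries
  induction gs with
  | nil => rfl
  | cons g gs ih =>
    cases g with
    | gate s e =>
      rw [List.filter_cons_of_neg (by simp [QGate.IsOracleFree])]
      exact ih
    | oracle k e =>
      rw [List.filter_cons_of_pos (by simp [QGate.IsOracleFree]), List.length_cons]
      exact congrArg (· + 1) ih

/-- The substituted list is oracle-free when the blocks are. [folklore] -/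
theorem substGates_isOracleFree (B : OracleImpl G) (hB : ∀ k, (B.circ k).IsOracleFree) (hNW : N ≤ W) :
    ∀ (off : ℕ) (gs : List (QGate G N)), ∀ g ∈ substGates B hNW off gs, g.IsOracleFree
  | _, [] => by simp [substGates]
  | off, QGate.gate s e :: gs => by
    intro g hg
    simp only [substGates, List.mem_cons] at hg
    rcases hg with rfl | hg
    · trivial
    · exact substGates_isOracleFree B hB hNW off gs g hg
  | off, QGate.oracle k e :: gs => by
    intro g hg
    simp only [substGates] at hg
    split_ifs at hg with h
    · rcases List.mem_append.1 hg with hg | hg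
      · exact isOracleFree_mapWires _ (hB k) g hg
      · exact substGates_isOracleFree B hB hNW _ gs g hg
    · exact substGates_isOracleFree B hB hNW off gs g hg

/-- The clean inputs of the ambient register: every wire `≥ N` reads `0`. [folklore] -/
def CleanAbove (N W : ℕ) : Set (QReg W) := {z | ∀ i : Fin W, N ≤ (i : ℕ) → z i = false}

/-- A gate placed on the first `N` wires preserves `CleanAbove N W`. [folklore] -/
theorem preservesSupp_cleanAbove_placeGate {k : ℕ} (hNW : N ≤ W) (e : Fin k ↪ Fin N)
    (M : Matrix (QReg k) (QReg k) ℂ) :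
    PreservesSupp (CleanAbove N W) (placeGate (e.trans (Fin.castLEEmb hNW)) M) := by
  refine preservesSupp_placeGate_of_offWires _ (fun x y hxy => ?_) M
  have key : ∀ i : Fin W, N ≤ (i : ℕ) → x i = y i := fun i hi =>
    hxy i (by
      rintro ⟨j, rfl⟩
      simp only [Function.Embedding.trans_apply, Fin.castLEEmb_apply, Fin.val_castLE] at hi
      exact absurd (e j).isLt (Nat.not_lt.2 hi))
  exact ⟨fun hx i hi => (key i hi) ▸ hx i hi, fun hy i hi => (key i hi).symm ▸ hy i hi⟩

/-- The matrix of a concatenation of gate lists (second list on the left). [folklore] -/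
theorem toMatrix_mk_append (A : Language Bool) (l₁ l₂ : List (QGate G N)) :
    (⟨l₁ ++ l₂⟩ : QCircuit G N).toMatrix A =
      (⟨l₂⟩ : QCircuit G N).toMatrix A * (⟨l₁⟩ : QCircuit G N).toMatrix A :=
  QCircuit.toMatrix_append A ⟨l₁⟩ ⟨l₂⟩

/-- An ancilla wire of a block, as `Fin.natAdd` of its index. [folklore] -/
theorem exists_eq_natAdd {k a : ℕ} (i : Fin (k + 1 + a)) (hi : k + 1 ≤ (i : ℕ)) :
    ∃ j : Fin a, i = Fin.natAdd (k + 1) j :=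
  ⟨⟨(i : ℕ) - (k + 1), by omega⟩, Fin.ext (by simp; omega)⟩

/-- Clean ambient inputs are clean block inputs for every placed block. [folklore] -/
theorem cleanAbove_subset_comp_blockEmb {k : ℕ} (e : Fin (k + 1) ↪ Fin N) (off a : ℕ)
    (hN : N ≤ off) (hW : off + a ≤ W) :
    CleanAbove N W ⊆ {z | z ∘ blockEmb e off a hN hW ∈ Clean k a} := by
  intro z hz i hi
  obtain ⟨j, rfl⟩ := exists_eq_natAdd i hi
  simp only [Function.comp_apply, blockEmb_apply, blockMap_natAdd]
  exact hz _ (by simp only; omega)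

variable (hG : G.IsUnitary)
include hG

/-- Over a unitary gate set the matrix of a circuit is a contraction. [folklore] -/
theorem isContraction_toMatrix {M : ℕ} (A : Language Bool) (C : QCircuit G M) :
    IsContraction (C.toMatrix A) :=
  isContraction_of_mem_unitaryGroup (QCircuit.toMatrix_mem_unitaryGroup_holds hG A _)

/-- **The substituted circuit implements the original oracle circuit, idle on the fresh wires,
up to `numOracle · ε` on clean inputs** (errors add along the product; each block is transported
along its placement). [cite: BennettBernsteinBrassardVazirani1997, Cor. 4.15 (BQP^BQP = BQP)] [cite: NielsenChuang2010, §4.5.3 Box 4.1 eq. (4.63)] -/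
theorem implOn_substGates (B : OracleImpl G) {A : Language Bool} {ε : ℝ} (hB : B.Implements A ε)
    (hε : 0 ≤ ε) (hNW : N ≤ W) (A' : Language Bool) :
    ∀ (gs : List (QGate G N)) (off : ℕ), N ≤ off → off + extra B gs ≤ W →
      ImplOn (CleanAbove N W) ((⟨substGates B hNW off gs⟩ : QCircuit G W).toMatrix A')
        (placeGate (Fin.castLEEmb hNW) ((⟨gs⟩ : QCircuit G N).toMatrix A)) (numOracle gs * ε)
  | [], off, _, _ => by
    simp only [substGates, QCircuit.toMatrix_nil, placeGate_one, numOracle, Nat.cast_zero, zero_mul]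
    exact ImplOn.refl _ _
  | QGate.gate s e :: gs, off, hoff, hW => by
    have ih := implOn_substGates B hB hε hNW A' gs off hoff hW
    simp only [substGates, QCircuit.toMatrix_cons, numOracle]
    rw [placeGate_mul_holds, toMatrix_mapWiresGate, QGate.toMatrix_gate, QGate.toMatrix_gate,
      placeGate_placeGate]
    have h1 : ImplOn (CleanAbove N W) (placeGate (e.trans (Fin.castLEEmb hNW)) (G.mat s))
        (placeGate (e.trans (Fin.castLEEmb hNW)) (G.mat s)) 0 := ImplOn.refl _ _
    have h := ImplOn.mul ih h1 (isContraction_toMatrix hG A' _)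
      (isContraction_of_mem_unitaryGroup (placeGate_mem_unitaryGroup_holds _ (hG s)))
      (preservesSupp_cleanAbove_placeGate hNW e _) (mul_nonneg (Nat.cast_nonneg _) hε)
    simpa using h
  | QGate.oracle k e :: gs, off, hoff, hW => by
    have hW' : off + (B.anc k + extra B gs) ≤ W := by simpa only [extra] using hW
    have hfit : N ≤ off ∧ off + B.anc k ≤ W := ⟨hoff, by omega⟩
    have ih := implOn_substGates B hB hε hNW A' gs (off + B.anc k) (by omega) (by omega)
    simp only [substGates, dif_pos hfit, QCircuit.toMatrix_cons, numOracle]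
    rw [toMatrix_mk_append, placeGate_mul_holds, QGate.toMatrix_oracle, placeGate_placeGate]
    set E := blockEmb e off (B.anc k) hfit.1 hfit.2 with hE
    have hideal : placeGate (e.trans (Fin.castLEEmb hNW)) (oracleGate A k) =
        placeGate E (placeGate (Fin.castAddEmb (B.anc k)) (oracleGate A k)) := by
      rw [placeGate_placeGate, castAddEmb_trans_blockEmb]
    have h1 : ImplOn (CleanAbove N W)
        ((⟨(mapWires E (B.circ k)).gates⟩ : QCircuit G W).toMatrix A')
        (placeGate (e.trans (Fin.castLEEmb hNW)) (oracleGate A k)) ε := by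
      rw [show (⟨(mapWires E (B.circ k)).gates⟩ : QCircuit G W) = mapWires E (B.circ k) from rfl,
        toMatrix_mapWires, QCircuit.toMatrix_eq_of_isOracleFree (hB.isOracleFree k) A' 0, hideal]
      exact ((hB.implOn k).placeGate E hε).of_subset (cleanAbove_subset_comp_blockEmb e off _ hfit.1 hfit.2)
    have h := ImplOn.mul ih h1 (isContraction_toMatrix hG A' _)
      (isContraction_of_mem_unitaryGroup
        (placeGate_mem_unitaryGroup_holds _ (oracleGate_mem_unitaryGroup_holds A k)))
      (preservesSupp_cleanAbove_placeGate hNW e _) (mul_nonneg (Nat.cast_nonneg _) hε)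
    convert h using 1
    push_cast
    ring

end Subst

/-! ### The substituted family and its output distribution -/

section Family

/-- **The substituted family**: at input length `n`, the circuit of `F` (on `n + F.ancillas n`
wires) with its oracle gates replaced by the blocks `B n`, the fresh ancilla wires appended after
those of `F`. [cite: BennettBernsteinBrassardVazirani1997, Cor. 4.15 (BQP^BQP = BQP)] -/
def substFamily (F : QCircuitFamily G) (B : ℕ → OracleImpl G) : QCircuitFamily G where
  ancillas n := F.ancillas n + extra (B n) (F.circ n).gates
  circ n := ⟨substGates (B n) (N := n + F.ancillas n)
    (W := n + (F.ancillas n + extra (B n) (F.circ n).gates)) (by omega) (n + F.ancillas n)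
    (F.circ n).gates⟩

/-- The substituted family is oracle-free when the blocks are. [folklore] -/
theorem substFamily_isOracleFree (F : QCircuitFamily G) (B : ℕ → OracleImpl G)
    (hB : ∀ n k, ((B n).circ k).IsOracleFree) : (substFamily F B).IsOracleFree :=
  fun n => substGates_isOracleFree (B n) (hB n) _ _ _

/-- The padded input reads `0` beyond the input wires. [folklore] -/
theorem padInput_apply_of_le {n M : ℕ} (x : QReg n) (i : Fin (n + M)) (hi : n ≤ (i : ℕ)) :
    padInput x M i = false := by
  obtain ⟨j, rfl⟩ : ∃ j : Fin M, i = Fin.natAdd n j := ⟨⟨(i : ℕ) - n, by omega⟩, Fin.ext (by simp; omega)⟩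
  exact Fin.append_right _ _ _

/-- Restricting a padded input to the first `n + m` of `n + (m + X)` wires gives the padded input
with `m` ancillas. [folklore] -/
theorem padInput_comp_castLE {n m X : ℕ} (x : QReg n) (h : n + m ≤ n + (m + X)) :
    padInput x (m + X) ∘ Fin.castLE h = padInput x m := by
  funext i
  simp only [Function.comp_apply]
  induction i using Fin.addCases with
  | left j =>
    have e1 : Fin.castLE h (Fin.castAdd m j) = Fin.castAdd (m + X) j := Fin.ext rfl
    rw [e1, show padInput x m (Fin.castAdd m j) = x j from Fin.append_left _ _ _]
    exact Fin.append_left _ _ _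
  | right j =>
    rw [show padInput x m (Fin.natAdd n j) = false from Fin.append_right _ _ _]
    exact padInput_apply_of_le x _ (by simp)

/-- The measured string of a register that is `0` beyond wire `N` is the string of the first
`N` wires followed by zeros. [folklore] -/
theorem ofFn_eq_append_replicate {N W : ℕ} (hNW : N ≤ W) (z : QReg W)
    (hz : ∀ i : Fin W, N ≤ (i : ℕ) → z i = false) :
    List.ofFn z = List.ofFn (z ∘ Fin.castLE hNW) ++ List.replicate (W - N) false := by
  apply List.ext_getElem
  · simp; omega
  · intro i h₁ h₂
    rw [List.getElem_ofFn]
    by_cases hi : i < N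
    · rw [List.getElem_append_left (by simpa using hi), List.getElem_ofFn]
      rfl
    · rw [List.getElem_append_right (by simpa using Nat.not_lt.1 hi), List.getElem_replicate]
      exact hz _ (Nat.not_lt.1 hi)

/-- Kernel probabilities are monotone in the event. [folklore] -/
theorem _root_.Literature.Computability.Cryptography.QCircuitFamily.kernelProb_mono
    (F : QCircuitFamily G) (A : Language Bool) (x : List Bool) {E E' : Set (List Bool)} (h : E ⊆ E') :
    F.kernelProb A x E ≤ F.kernelProb A x E' := by
  unfold QCircuitFamily.kernelProb
  refine ENNReal.toReal_mono (ne_top_of_le_ne_top ENNReal.one_ne_top ?_)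
    ((F.kernel A x).toOuterMeasure_mono fun y hy => h hy.1)
  rw [← ((F.kernel A x).toOuterMeasure_apply_eq_one_iff Set.univ).2 (Set.subset_univ _)]
  exact (F.kernel A x).toOuterMeasure_mono (Set.subset_univ _)

/-- **The output distribution of the substituted family** (Clifford+T): for every event `E`,
the substituted (oracle-free) family outputs a string in `E` with probability at least
`P_F^A[y ++ 0^X ∈ E] − numOracle · ε`, where `y` is the measured output of the original family
run WITH the oracle `A` and `X` the number of fresh wires — in the ideal run the fresh wires stay
`0`, the substituted run is within `numOracle · ε` of it (`implOn_substGates`), and close states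
have close statistics (BBBV Thm. 3.1). [cite: BennettBernsteinBrassardVazirani1997, Cor. 4.15 (BQP^BQP = BQP) with Thm. 3.1] -/
theorem kernelProb_substFamily_ge (F : QCircuitFamily cliffordT) (B : ℕ → OracleImpl cliffordT)
    (A : Language Bool) (ε : ℕ → ℝ) (hε : ∀ n, 0 ≤ ε n) (hB : ∀ n, (B n).Implements A (ε n))
    (x : List Bool) (E : Set (List Bool)) :
    F.kernelProb A x {y | y ++ List.replicate (extra (B x.length) (F.circ x.length).gates) false ∈ E}
        - numOracle (F.circ x.length).gates * ε x.length ≤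
      (substFamily F B).kernelProb 0 x E := by
  classical
  -- notation
  set n := x.length with hn
  set m := F.ancillas n with hm
  set X := extra (B n) (F.circ n).gates with hX
  have hNW : n + m ≤ n + (m + X) := by omega
  set V := (F.circ n).toMatrix A with hV
  set w : QReg (n + (m + X)) := padInput x.get (m + X) with hw
  have hwN : ∀ i : Fin (n + (m + X)), n + m ≤ (i : ℕ) → w i = false := fun i hi =>
    padInput_apply_of_le _ _ (by omega)
  -- the substituted family's kernel as a Born sum
  have hK : (substFamily F B).kernelProb 0 x E = ∑ z : QReg (n + (m + X)),
      if List.ofFn z ∈ E then ‖(((substFamily F B).circ n).toMatrix 0 *ᵥ basisState w) z‖ ^ 2 else 0 := by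
    change (((((substFamily F B).circ n).outputPMF 0 x.get).map List.ofFn).toOuterMeasure E).toReal = _
    rw [toReal_outputPMF_map_ofFn]
    rfl
  -- the original family's kernel as a Born sum
  have hF : F.kernelProb A x {y | y ++ List.replicate X false ∈ E} = ∑ u : QReg (n + m),
      if List.ofFn u ++ List.replicate X false ∈ E then ‖V u (padInput x.get m)‖ ^ 2 else 0 := by
    change ((((F.circ n).outputPMF A x.get).map List.ofFn).toOuterMeasure
      {y | y ++ List.replicate X false ∈ E}).toReal = _
    rw [toReal_outputPMF_map_ofFn]
    refine Finset.sum_congr rfl fun u _ => ?_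
    rw [QCircuit.runOn, mulVec_basisState]
    rfl
  -- the ideal run: the original circuit on the first `n + m` wires, fresh wires idle
  have hideal : (∑ z : QReg (n + (m + X)), if List.ofFn z ∈ E then
      ‖(placeGate (Fin.castLEEmb hNW) V *ᵥ basisState w) z‖ ^ 2 else 0) =
      F.kernelProb A x {y | y ++ List.replicate X false ∈ E} := by
    rw [hF]
    have hXW : n + (m + X) - (n + m) = X := by omega
    have hterm : ∀ z : QReg (n + (m + X)),
        (if List.ofFn z ∈ E then ‖(placeGate (Fin.castLEEmb hNW) V *ᵥ basisState w) z‖ ^ 2 else 0) =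
          if List.ofFn (z ∘ Fin.castLEEmb hNW) ++ List.replicate X false ∈ E then
            ‖(placeGate (Fin.castLEEmb hNW) V *ᵥ basisState w) z‖ ^ 2 else 0 := by
      intro z
      by_cases hz : ∀ i : Fin (n + (m + X)), n + m ≤ (i : ℕ) → z i = false
      · rw [ofFn_eq_append_replicate hNW z hz, hXW]
        rfl
      · have h0 : (placeGate (Fin.castLEEmb hNW) V *ᵥ basisState w) z = 0 := by
          rw [placeGate_castLE_mulVec_basisState hNW V w hwN z, if_neg hz]
        simp [h0]
    simp_rw [hterm]
    rw [sum_normSq_placeGate_castLE hNW V w (fun u : QReg (n + m) => List.ofFn u ++ List.replicate X false ∈ E)]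
    refine Finset.sum_congr rfl fun u _ => ?_
    rw [show w ∘ Fin.castLEEmb hNW = padInput x.get m from padInput_comp_castLE x.get hNW]
  -- the substituted run is close to the ideal run
  have himpl : ImplOn (CleanAbove (n + m) (n + (m + X))) (((substFamily F B).circ n).toMatrix 0)
      (placeGate (Fin.castLEEmb hNW) V) (numOracle (F.circ n).gates * ε n) := by
    have h := implOn_substGates cliffordT_isUnitary_holds (B n) (hB n) (hε n) hNW 0 (F.circ n).gates (n + m) le_rfl
      (by omega)
    exact h
  have hstat := abs_sum_normSq_sub_le_of_implOn
    (QCircuit.toMatrix_mem_unitaryGroup_holds cliffordT_isUnitary_holds 0 _)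
    (placeGate_mem_unitaryGroup_holds _ (QCircuit.toMatrix_mem_unitaryGroup_holds cliffordT_isUnitary_holds A _))
    himpl (ψ := basisState w) (suppIn_basisState fun i hi => hwN i hi) (normSq_basisState w)
    (Finset.univ.filter fun z => List.ofFn z ∈ E)
  rw [Finset.sum_filter, Finset.sum_filter, hideal] at hstat
  rw [hK]
  exact sub_le_comm.1 (abs_sub_le_iff.1 hstat).2

end Family


end OracleImpl

end Literature.Computability.QuantumComplexity

end
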